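import Summits.HodgeConjecture.HodgeConjecture.Theorems.NikulinTwinTransportTwinSimilitudeAlgebraicCMNormSelfAnchor
import Summits.HodgeConjecture.HodgeConjecture.Theorems.NikulinTwinTransportTwinSimilitudeAlgebraicHKTwistorTransportOnSector
import Summits.HodgeConjecture.HodgeConjecture.Theorems.NikulinTwinTransportTwinSimilitudeAlgebraicOutAnchorGlue
import HarnessLib

/-!
# Route NikulinTwinTransport · crux X = `TwinSimilitudeAlgebraic` (stmt-HodgeConjecture-13674) —
# X AT EVERY TWIN PAIR WITH A CM-NORM-2 TWIN; THE r9 RESIDUAL (line `hyperkaehler-nikulin-anchors`, lead c5)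

The line `hyperkaehler-nikulin-anchors` proves X whenever EITHER twin lies in the HK-Nikulin sector
`T_ℚ ↪ (U³ ⊕ E₈(−2) ⊕ ⟨−2⟩)_ℚ` (rank `T ≤ 14`; `…HKTargetTheorem`, `…HKNamedFacts`).  With the self-anchor of a
CM-norm-2 surface (`outAnchor_self_of_cmNorm`, file `…CMNormSelfAnchor`: a rational `2`-self-similitude `e` of
`H²(S)` acting on `H^{2,0}` by a non-real scalar is algebraic by Buskin's CM corollary and has a rational,
type-preserving, halving inverse) the landed glue gives:

* `twinSimilitudeAlgebraic_at_of_cmNorm_target` / `_source` / `_either` — **X at every pair of projective K3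
  surfaces one of which is CM-norm-2**, granted ONLY K3 markings (`Huybrechts_K3_marking_exists`), Buskin's CM
  corollary (`Buskin2019_hodgeConjectureFor_square_of_CM`), Buskin's theorem (`HodgeIsometryAlgebraic`, route
  item 13675) and the composition of correspondences (`CupProductAlgebraic`, item 14350, a consequence of
  Voisin I Thm. 11.32 ⊗ ℂ).  NO sector hypothesis — the mechanism works at every rank of `T` (CM-norm-2 surfaces
  exist at every even rank `≤ 20`), far off the sector where the involution anchors of the line stop.
* `stub_cmNormTwins` — the registered stub of the r9 skeleton (statement verbatim).
* `twinTwistorTransport_at_of_cmNorm` — the sibling crux `TwinTwistorTransport` (14393) at every CM-norm-2 surface (the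
  self-anchor as a transport datum, `anchorData_of_outAnchor`), from markings + Buskin's CM corollary alone.
* `twinSimilitudeAlgebraic_of_offSectorNonCMPairs` / `cmNormTwins_residual_anchor` — hence the crux REDUCES to
  the pairs with BOTH twins off the HK-Nikulin sector AND NEITHER twin CM-norm-2 (the r9 residual
  `OffSectorNonCMPairs`): the locus where no published mechanism applies (`End_Hdg(T)` totally real, or CM with
  `2 ∉ N_{E/E₀}(E^×)`, at rank `T ≥ 15` or a doubly Hasse-obstructed type of rank 13/14).

No definitions, no new named facts, no `sorry`.

## References

* [Buskin2019] N. Buskin, J. reine angew. Math. 755 (2019), Thm. 1.1, Corollary (Introduction), Lemma 6.3.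
* [Huybrechts2019] D. Huybrechts, Comment. Math. Helv. 94 (2019), Cor. 0.4 (ii) and Rem. 3.3.
* [Varesco2023] M. Varesco, Math. Z. 305 (2023), §0.1 (known cases: CM), Thm. 2.1 and Prop. 2.5.
* [VanGeemenSchuett2023] B. van Geemen, M. Schütt, arXiv:2310.05196, Thm. 3.10 and Rem. 4.9.
* [CamereEtAl2026] C. Camere, A. Garbagnati, G. Kapustka, M. Kapustka, arXiv:2607.00130, Thm. 1.2.
* [VoisinHodgeI2002] C. Voisin, Hodge Theory and Complex Algebraic Geometry I, CUP 2002, Thm. 11.32.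
-/

noncomputable section

set_option linter.dupNamespace false

open CategoryTheory MonoidalCategory
open scoped Manifold Matrix
open Literature.AlgebraicGeometry.Motives Literature.AlgebraicGeometry.HodgeTheory
open Literature.AlgebraicGeometry.Surfaces Literature.AlgebraicGeometry.Hyperkaehler Literature.Geometry.Kaehler
open Literature.AlgebraicTopology.SingularHomology
open Summit.HodgeConjecture.HodgeConjecture.Theses.NikulinTwinTransport

namespace Summit.HodgeConjecture.HodgeConjecture.Theorems.NikulinTwinTransport

/-! ## Local notations (verbatim those of the route's Theorems files) -/

/-- `Gen[S, p]`: `p` is an integral generator of `H⁴(S(ℂ); ℂ)` (the generator clause of X). Local notation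
only. -/
local notation3 (prettyPrint := false) "Gen[" S ", " p "]" =>
  (IsIntegralClass p ∧ ∀ q : complexBetti S (2 * 2), IsIntegralClass q → ∃ n : ℤ, q = n • p)

/-- `Corr[μ, S, S', hS, hS' ; γ, y] = [γ]_* y = fst_*(snd^* y ∪ γ)`, the action of
`γ ∈ H⁴((S ⊗ S′)(ℂ); ℂ)` as a correspondence `H²(S′) → H²(S)` (the FIRST factor receives). Local notation
only, verbatim from the route's Theorems files. -/
local notation3 (prettyPrint := false) "Corr[" μ ", " S ", " S' ", " hS ", " hS' " ; " γ ", " y "]" =>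
  complexGysin μ
    (IsSmoothProjective.tensor_holds (IsK3Surface.isSmoothProjective hS)
      (IsK3Surface.isSmoothProjective hS'))
    (IsK3Surface.isSmoothProjective hS) (SemiCartesianMonoidalCategory.fst S S')
    (rfl : 2 * 1 + 2 * 2 + 2 * 2 = 2 * 1 + 2 * (2 + 2))
    (cupProduct (rfl : 2 * 1 + 2 * 2 = 2 * 1 + 2 * 2)
      (complexBetti.map (SemiCartesianMonoidalCategory.snd S S') (2 * 1) y) γ)

/-- `XBody[μ, S, S', hS, hS', p, p']`: the body of X at one pair after the generator prefix — every rational,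
type-preserving `2`-similitude `ψ : H²(S′) → H²(S)` is the action of an algebraic class on `S ⊗ S′`.
Local notation only (verbatim the corresponding segment of the route decl). -/
local notation3 (prettyPrint := false) "XBody[" μ ", " S ", " S' ", " hS ", " hS' ", " p ", " p' "]" =>
  ∀ (ψ : complexBetti S' (2 * 1) →ₗ[ℂ] complexBetti S (2 * 1)),
    (∀ x, IsRationalClass x → IsRationalClass (ψ x)) →
    (∀ (i j : ℕ) x, IsOfHodgeType 2 S' (2 * 1) i j x → IsOfHodgeType 2 S (2 * 1) i j (ψ x)) →
    (∀ (x y : complexBetti S' (2 * 1)) (a : ℂ),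
      cupProduct (rfl : 2 * 1 + 2 * 1 = 2 * 2) x y = a • p' →
        cupProduct (rfl : 2 * 1 + 2 * 1 = 2 * 2) (ψ x) (ψ y) = ((2 : ℂ) * a) • p) →
    ∃ γ ∈ algebraicClasses (MonoidalCategoryStruct.tensorObj S S') 2,
      ∀ x : complexBetti S' (2 * 1), ψ x = Corr[μ, S, S', hS, hS' ; γ, x]

/-- `CMNorm2[S, p]`: **`S` is CM-norm-2** — `H²(S(ℂ); ℂ)` carries a rational `2`-self-similitude `e`
(`(x.y) = a·p ⟹ (ex.ey) = 2a·p`, `p` the chosen generator of `H⁴`) acting on a non-zero `(2,0)`-class by a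
non-real scalar.  For a projective K3 surface: `End_Hdg(T(S)_ℚ)` is a CM field containing an element of
relative norm `2` (Zarhin; Huybrechts Ch. 3 Thm. 3.7); in particular `HasComplexMultiplication S`
(`hasComplexMultiplication_of_cmNorm`). Local notation only.
[cite: Huybrechts2016K3, Ch. 3 Thm. 3.7 and Rem. 3.10] [cite: Zarhin1983HodgeGroupsK3, Thm. 1.5.1] -/
local notation3 (prettyPrint := false) "CMNorm2[" S ", " p "]" =>
  ∃ e : complexBetti S (2 * 1) →ₗ[ℂ] complexBetti S (2 * 1),
    (∀ x, IsRationalClass x → IsRationalClass (e x)) ∧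
    (∀ (x y : complexBetti S (2 * 1)) (a : ℂ),
      cupProduct (rfl : 2 * 1 + 2 * 1 = 2 * 2) x y = a • p →
        cupProduct (rfl : 2 * 1 + 2 * 1 = 2 * 2) (e x) (e y) = ((2 : ℂ) * a) • p) ∧
    ∃ (σ : complexBetti S (2 * 1)) (t : ℂ), IsOfHodgeType 2 S (2 * 1) 2 0 σ ∧ σ ≠ 0 ∧ t.im ≠ 0 ∧ e σ = t • σ

/-- `AnchorData[μ, S, hS, p]`: the body of the transport crux `TwinTwistorTransport` (stmt-HodgeConjecture-14393) at `S`
after its `∀ μ, PD → ∀ S hS p, Gen →` prefix — a projective K3 partner `S″`, a generator `p″` and an algebraic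
`Ψ : H²(S″) ≃ H²(S)` whose inverse is rational, type-preserving and halves the cup form (verbatim the notation of
`…HKTwistorTransportOnSector`). Local notation only. -/
local notation3 (prettyPrint := false) "AnchorData[" μ ", " S ", " hS ", " p "]" =>
  ∃ (S'' : SchemeOver ℂ) (hS'' : IsK3Surface S'') (p'' : complexBetti S'' (2 * 2)),
    Gen[S'', p''] ∧
    ∃ Ψ : complexBetti S'' (2 * 1) ≃ₗ[ℂ] complexBetti S (2 * 1),
      (∀ y, IsRationalClass y → IsRationalClass (Ψ.symm y)) ∧
      (∀ (i j : ℕ) y, IsOfHodgeType 2 S (2 * 1) i j y →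
        IsOfHodgeType 2 S'' (2 * 1) i j (Ψ.symm y)) ∧
      (∀ (u v : complexBetti S (2 * 1)) (b : ℂ),
        cupProduct (rfl : 2 * 1 + 2 * 1 = 2 * 2) u v = ((2 : ℂ) * b) • p →
          cupProduct (rfl : 2 * 1 + 2 * 1 = 2 * 2) (Ψ.symm u) (Ψ.symm v) = b • p'') ∧
      ∃ γ ∈ algebraicClasses (MonoidalCategoryStruct.tensorObj S S'') 2,
        ∀ x : complexBetti S'' (2 * 1), Ψ x = Corr[μ, S, S'', hS, hS'' ; γ, x]

/-! ## X at every pair with a CM-norm-2 twin -/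

/-- **X at every pair whose TARGET is CM-norm-2**: the target is its own anchor
(`outAnchor_self_of_cmNorm`), and X follows by the landed target glue `simAlg_at_of_outAnchor_target`
(`½ e ∘ ψ : H²(S′) → H²(S)` is a rational Hodge ISOMETRY, algebraic by Buskin; `e⁻¹` is algebraic by the
transpose calculus; compose).  Granted markings, Buskin's CM corollary, Buskin's theorem
(`HodgeIsometryAlgebraic`, 13675) and `CupProductAlgebraic` (14350); NO sector hypothesis, any rank of `T`.
[cite: Buskin2019, Thm. 1.1 and Corollary] [cite: Huybrechts2019, Cor. 0.4 (ii)] [cite: Varesco2023, §0.1] -/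
theorem twinSimilitudeAlgebraic_at_of_cmNorm_target (hmk : Huybrechts_K3_marking_exists)
    (hBCM : Buskin2019_hodgeConjectureFor_square_of_CM)
    (hC : Summit.HodgeConjecture.HodgeConjecture.Theses.EndoscopicMiddleDegree.CupProductAlgebraic)
    (hB : HodgeIsometryAlgebraic) {μ : OrientationFamily} (hμ : μ.HasPoincareDuality)
    (S S' : SchemeOver ℂ) (hS : IsK3Surface S) (hS' : IsK3Surface S')
    (p : complexBetti S (2 * 2)) (p' : complexBetti S' (2 * 2)) (hp : Gen[S, p]) (hp' : Gen[S', p'])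
    (hcm : CMNorm2[S, p]) : XBody[μ, S, S', hS, hS', p, p'] :=
  simAlg_at_of_outAnchor_target hmk hB (compCorr_of_cupProductAlgebraic' hC) hμ hS hp hS hp
    (outAnchor_self_of_cmNorm hmk hBCM hμ hS hp hcm) S' hS' p' hp'

/-- **X at every pair whose SOURCE is CM-norm-2**: the source is its own anchor, and X follows by the
landed source glue `simAlg_at_of_outAnchor` (`ψ ∘ e⁻¹ : H²(S′) → H²(S)` is a rational Hodge ISOMETRY,
algebraic by Buskin; compose with `e = [γ_e]_*`).  Same inputs; NO sector hypothesis.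
[cite: Buskin2019, Thm. 1.1 and Corollary] [cite: Huybrechts2019, Cor. 0.4 (ii)] [cite: Varesco2023, §0.1] -/
theorem twinSimilitudeAlgebraic_at_of_cmNorm_source (hmk : Huybrechts_K3_marking_exists)
    (hBCM : Buskin2019_hodgeConjectureFor_square_of_CM)
    (hC : Summit.HodgeConjecture.HodgeConjecture.Theses.EndoscopicMiddleDegree.CupProductAlgebraic)
    (hB : HodgeIsometryAlgebraic) {μ : OrientationFamily} (hμ : μ.HasPoincareDuality)
    (S S' : SchemeOver ℂ) (hS : IsK3Surface S) (hS' : IsK3Surface S')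
    (p : complexBetti S (2 * 2)) (p' : complexBetti S' (2 * 2)) (hp : Gen[S, p]) (hp' : Gen[S', p'])
    (hcm : CMNorm2[S', p']) : XBody[μ, S, S', hS, hS', p, p'] :=
  fun ψ hψr hψt hψs =>
    simAlg_at_of_outAnchor hB (compCorr_of_cupProductAlgebraic' hC) hμ hS' hS' hp'
      (outAnchor_self_of_cmNorm hmk hBCM hμ hS' hp' hcm) S hS p hp ψ hψr hψt hψs

/-- **X whenever EITHER twin is CM-norm-2.** (The two cases coincide on twin pairs — `ψ` transports
`End_Hdg(T)` — but both are recorded, the residual below negating each separately.)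
[cite: Buskin2019, Thm. 1.1 and Corollary] [cite: Huybrechts2019, Cor. 0.4 (ii)] -/
theorem twinSimilitudeAlgebraic_at_of_cmNorm_either (hmk : Huybrechts_K3_marking_exists)
    (hBCM : Buskin2019_hodgeConjectureFor_square_of_CM)
    (hC : Summit.HodgeConjecture.HodgeConjecture.Theses.EndoscopicMiddleDegree.CupProductAlgebraic)
    (hB : HodgeIsometryAlgebraic) {μ : OrientationFamily} (hμ : μ.HasPoincareDuality)
    (S S' : SchemeOver ℂ) (hS : IsK3Surface S) (hS' : IsK3Surface S')
    (p : complexBetti S (2 * 2)) (p' : complexBetti S' (2 * 2)) (hp : Gen[S, p]) (hp' : Gen[S', p'])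
    (hcm : CMNorm2[S', p'] ∨ CMNorm2[S, p]) : XBody[μ, S, S', hS, hS', p, p'] := by
  rcases hcm with hcm | hcm
  · exact twinSimilitudeAlgebraic_at_of_cmNorm_source hmk hBCM hC hB hμ S S' hS hS' p p' hp hp' hcm
  · exact twinSimilitudeAlgebraic_at_of_cmNorm_target hmk hBCM hC hB hμ S S' hS hS' p p' hp hp' hcm

/-! ## The transport crux at CM-norm-2 surfaces -/

/-- **The transport crux `TwinTwistorTransport` (stmt-HodgeConjecture-14393) holds at every CM-norm-2 projective K3
surface**: the self-anchor `e` read as a transport datum with partner `S″ := S` (`anchorData_of_outAnchor`: `Ψ := 2e⁻¹`,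
algebraic by the transpose calculus; `Ψ⁻¹ = ½e` rational, type-preserving, halving).  Granted K3 markings and Buskin's CM
corollary only — no Buskin theorem, no composition, no sector hypothesis; so the common open core of X and 14393 loses the
CM-norm-2 locus at every rank of `T`. [cite: Buskin2019, Corollary (Introduction)] [cite: Huybrechts2019, Cor. 0.4 (ii)] -/
theorem twinTwistorTransport_at_of_cmNorm (hmk : Huybrechts_K3_marking_exists)
    (hBCM : Buskin2019_hodgeConjectureFor_square_of_CM) {μ : OrientationFamily} (hμ : μ.HasPoincareDuality)
    {S : SchemeOver ℂ} (hS : IsK3Surface S) {p : complexBetti S (2 * 2)} (hp : Gen[S, p]) (hcm : CMNorm2[S, p]) :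
    AnchorData[μ, S, hS, p] :=
  anchorData_of_outAnchor hmk hμ hS hp hS hp (outAnchor_self_of_cmNorm hmk hBCM hμ hS hp hcm)

/-! ## The crux reduced to off-sector, non-CM-norm pairs -/

/-- `OffSectorNonCMPairs`: **the r9 residual of line `hyperkaehler-nikulin-anchors`** — X verbatim for pairs
with BOTH twins off the HK-Nikulin sector (`T_ℚ ↪̸ (U³ ⊕ E₈(−2) ⊕ ⟨−2⟩)_ℚ`) AND NEITHER twin CM-norm-2: the
locus where no published mechanism applies (`End_Hdg(T)` totally real, or CM without an element of relative
norm `2`, at rank `T ≥ 15` or a doubly Hasse-obstructed type of rank 13/14).  Implied by X; an open sub-case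
of the Hodge conjecture for `S × S′`. Local notation only. [cite: Varesco2023, §0.1, Thm. 2.1 and Prop. 2.5]
[cite: VanGeemenSchuett2023, Thm. 3.10 and Rem. 4.9] -/
local notation3 (prettyPrint := false) "OffSectorNonCMPairs" =>
  ∀ (μ : OrientationFamily), μ.HasPoincareDuality →
    ∀ (S S' : SchemeOver ℂ) (hS : IsK3Surface S) (hS' : IsK3Surface S')
      (p : complexBetti S (2 * 2)) (p' : complexBetti S' (2 * 2)), Gen[S, p] → Gen[S', p'] →
      ∀ (ψ : complexBetti S' (2 * 1) →ₗ[ℂ] complexBetti S (2 * 1)),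
        (∀ x, IsRationalClass x → IsRationalClass (ψ x)) →
        (∀ (i j : ℕ) x, IsOfHodgeType 2 S' (2 * 1) i j x → IsOfHodgeType 2 S (2 * 1) i j (ψ x)) →
        (∀ (x y : complexBetti S' (2 * 1)) (a : ℂ),
          cupProduct (rfl : 2 * 1 + 2 * 1 = 2 * 2) x y = a • p' →
            cupProduct (rfl : 2 * 1 + 2 * 1 = 2 * 2) (ψ x) (ψ y) = ((2 : ℂ) * a) • p) →
        ¬ InHKNikulinSector S' → ¬ InHKNikulinSector S → ¬ CMNorm2[S', p'] → ¬ CMNorm2[S, p] →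
        ∃ γ ∈ algebraicClasses (MonoidalCategoryStruct.tensorObj S S') 2,
          ∀ x : complexBetti S' (2 * 1), ψ x = Corr[μ, S, S', hS, hS' ; γ, x]

/-- **The residual is weaker than X** (drop the four negated hypotheses). [folklore] -/
theorem offSectorNonCMPairs_of_twinSimilitudeAlgebraic
    (h : Summit.HodgeConjecture.HodgeConjecture.Theses.NikulinTwinTransport.TwinSimilitudeAlgebraic) :
    OffSectorNonCMPairs :=
  fun μ hμ S S' hS hS' p p' hp hp' ψ hψr hψt hψs _ _ _ _ => h μ hμ S S' hS hS' p p' hp hp' ψ hψr hψt hψs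

/-- **THE CRUX FROM NAMED FACTS AND THE r9 RESIDUAL.**  Granted the named published facts of the line
(K3 markings and the four hyperkähler facts F1–F4; Voisin I Thm. 11.32 ⊗ ℂ; Buskin's CM corollary), the two
open items of this route entering by name (Buskin `HodgeIsometryAlgebraic` 13675, `LefschetzOneOneK3` 13678)
and the residual `OffSectorNonCMPairs`, X = `TwinSimilitudeAlgebraic` holds: by cases — a twin in the
HK-Nikulin sector (`twinSimilitudeAlgebraic_onHKSector_either_of_namedFacts`), else a CM-norm-2 twin
(`twinSimilitudeAlgebraic_at_of_cmNorm_either`), else the residual.  A CONDITIONAL proof of the crux.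
[cite: Varesco2023, §0.1, Thm. 2.1 and Prop. 2.5] [cite: CamereEtAl2026, Thm. 1.2] [cite: Buskin2019, Thm. 1.1 and Corollary]
[cite: VoisinHodgeI2002, Thm. 11.32] -/
theorem twinSimilitudeAlgebraic_of_offSectorNonCMPairs
    (h₀ : (Huybrechts_K3_marking_exists ∧ CamereEtAl2026_symplecticInvolution_periodSurjective ∧
        CamereEtAl2023_fixedK3_restriction ∧ Markman2024_rationalHodgeIsometry_algebraic_marked ∧
        Beauville1983_hilbertSquare_markedIncidence))
    (hV : span_holomorphicBundleChernCharacter_eq_algebraicClasses)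
    (hBCM : Buskin2019_hodgeConjectureFor_square_of_CM)
    (hB : HodgeIsometryAlgebraic) (hL : LefschetzOneOneK3) (hres : OffSectorNonCMPairs) :
    Summit.HodgeConjecture.HodgeConjecture.Theses.NikulinTwinTransport.TwinSimilitudeAlgebraic := by
  intro μ hμ S S' hS hS' p p' hp hp' ψ hψr hψt hψs
  by_cases hsec : InHKNikulinSector S' ∨ InHKNikulinSector S
  · exact twinSimilitudeAlgebraic_onHKSector_either_of_namedFacts h₀ hV hB hL hμ S S' hS hS' p p' hp hp'
      hsec ψ hψr hψt hψs
  · by_cases hcm : CMNorm2[S', p'] ∨ CMNorm2[S, p]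
    · exact twinSimilitudeAlgebraic_at_of_cmNorm_either h₀.1 hBCM (cupProductAlgebraic_of_chernCharacterSpan hV)
        hB hμ S S' hS hS' p p' hp hp' hcm ψ hψr hψt hψs
    · exact hres μ hμ S S' hS hS' p p' hp hp' ψ hψr hψt hψs (fun h => hsec (Or.inl h))
        (fun h => hsec (Or.inr h)) (fun h => hcm (Or.inl h)) (fun h => hcm (Or.inr h))

/-- **Registered stub `stub_cmNormTwins` of the r9 skeleton of line `hyperkaehler-nikulin-anchors`** (statement
verbatim; closed form of `twinSimilitudeAlgebraic_at_of_cmNorm_either`): X at every pair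
of projective K3 surfaces with a CM-norm-2 source or target, from K3 markings, Buskin's CM corollary,
`CupProductAlgebraic` (14350) and Buskin's theorem (13675). [cite: Buskin2019, Thm. 1.1 and Corollary]
[cite: Huybrechts2019, Cor. 0.4 (ii)] -/
theorem stub_cmNormTwins :
    Huybrechts_K3_marking_exists → Buskin2019_hodgeConjectureFor_square_of_CM →
      Summit.HodgeConjecture.HodgeConjecture.Theses.EndoscopicMiddleDegree.CupProductAlgebraic →
      HodgeIsometryAlgebraic →
      ∀ (μ : OrientationFamily), μ.HasPoincareDuality →
        ∀ (S S' : SchemeOver ℂ) (hS : IsK3Surface S) (hS' : IsK3Surface S')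
          (p : complexBetti S (2 * 2)) (p' : complexBetti S' (2 * 2)), Gen[S, p] → Gen[S', p'] →
          (CMNorm2[S', p'] ∨ CMNorm2[S, p]) →
          ∀ (ψ : complexBetti S' (2 * 1) →ₗ[ℂ] complexBetti S (2 * 1)),
            (∀ x, IsRationalClass x → IsRationalClass (ψ x)) →
            (∀ (i j : ℕ) x, IsOfHodgeType 2 S' (2 * 1) i j x → IsOfHodgeType 2 S (2 * 1) i j (ψ x)) →
            (∀ (x y : complexBetti S' (2 * 1)) (a : ℂ),
              cupProduct (rfl : 2 * 1 + 2 * 1 = 2 * 2) x y = a • p' →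
                cupProduct (rfl : 2 * 1 + 2 * 1 = 2 * 2) (ψ x) (ψ y) = ((2 : ℂ) * a) • p) →
            ∃ γ ∈ algebraicClasses (MonoidalCategoryStruct.tensorObj S S') 2,
              ∀ x : complexBetti S' (2 * 1), ψ x = Corr[μ, S, S', hS, hS' ; γ, x] :=
  fun hmk hBCM hC hB _ hμ S S' hS hS' p p' hp hp' hcm =>
    twinSimilitudeAlgebraic_at_of_cmNorm_either hmk hBCM hC hB hμ S S' hS hS' p p' hp hp' hcm

/-- Registered anchor, residual form: closed form of `twinSimilitudeAlgebraic_of_offSectorNonCMPairs` — X from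
the named facts, Buskin's CM corollary, the two open items of this route and the r9 residual.
[cite: Varesco2023, §0.1, Thm. 2.1 and Prop. 2.5] [cite: Buskin2019, Thm. 1.1 and Corollary] -/
theorem cmNormTwins_residual_anchor :
    (Huybrechts_K3_marking_exists ∧ CamereEtAl2026_symplecticInvolution_periodSurjective ∧
        CamereEtAl2023_fixedK3_restriction ∧ Markman2024_rationalHodgeIsometry_algebraic_marked ∧
        Beauville1983_hilbertSquare_markedIncidence) →
    span_holomorphicBundleChernCharacter_eq_algebraicClasses →
    Buskin2019_hodgeConjectureFor_square_of_CM → HodgeIsometryAlgebraic → LefschetzOneOneK3 →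
    OffSectorNonCMPairs →
    Summit.HodgeConjecture.HodgeConjecture.Theses.NikulinTwinTransport.TwinSimilitudeAlgebraic :=
  fun h₀ hV hBCM hB hL hres => twinSimilitudeAlgebraic_of_offSectorNonCMPairs h₀ hV hBCM hB hL hres

end Summit.HodgeConjecture.HodgeConjecture.Theorems.NikulinTwinTransport

end
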